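import Literature.NumberTheory.LFunctions.Zhang2022.NumericsSection15AppBR
import Literature.NumberTheory.LFunctions.Zhang2022.AppendixBTailB3Value
import Literature.NumberTheory.LFunctions.Zhang2022.AppendixBTailB3Fubini
import Literature.NumberTheory.LFunctions.Zhang2022.AppendixBTailB3Residue
import HarnessLib

/-!
# Zhang (2022) Appendix B: (B.3) AS PRINTED is refuted outright; (B.3) with the DERIVED `e″` is a theorem

Topic `Literature/NumberTheory/LFunctions/Zhang2022` (Landau–Siegel audit tree; verdict-neutral).
Y. Zhang, *Discrete mean estimates and the Landau–Siegel zero*, arXiv:2211.02515v1 (2022)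
[Zhang2022LandauSiegel] — **an unrefereed manuscript under adjudication; nothing in this file asserts
or denies its Theorems 1–2.** ZHANG-L lane, WP15 referee file (zl-w15-ref-1), Appendix B p. 108
(tex L5317–L5334), DAG nodes `Z22:(B.3)` / `Z22:§B.u015`.

`NumericsSection15AppBR` proved `Numerics.appB3R_chain_inconsistent : ¬ (EqB_3R c′ ∧ StepB_u015aR c′ ∧
StepB_u015bR c′)` — the printed (B.3) (tail `= e″_{1j}(STATED) + O(α₁)`) is incompatible with the two
steps of its own proof. Both steps are now THEOREMS of the tree — `AppendixBVarrho.stepB_u015aR_holds`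
(`AppendixBTailB3Fubini`, zl-w15-p3/p8 pool) and `AppendixBVarrho.stepB_u015bR_holds`
(`AppendixBTailB3Residue`, zl-w15-p8) — so the conditional inconsistency becomes an UNCONDITIONAL
refutation of the node `Typed.AppendixB.EqB_3R c′` for every (2.13)-constant `c′` (`not_eqB_3R`), and the
same two steps give (B.3) with the DERIVED constant `e″_{1j} = AppendixB.e1ppD j` as a closed theorem
(`eqB_3_derived_holds`, = `AppendixBVarrho.tailB3_sub_e1ppD_of` at the two `_holds`); the BANKED reading
`Typed.AppendixB.EqB_3 c′` (error `O(α𝓛)`, stronger) falls with it through the tree edge `eqB_3R_of`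
(`not_eqB_3`, rev 2).

CLASS (lane bookkeeping): `refuted-misstated` — the witness is the misprinted closed form of `e″_{1j}` in
Lemma 15.1/(B.3) (`e1ppj ≠ e1ppD`, certified gap `> 3.8·10⁻⁵` at `j = 1`); the minimal repaired statement
C′ = (B.3) at `e1ppD` is PROVED here, so the witness misses C′. Downstream the lane already reads
Lemma 15.1/(15.22)/(16.16)/(17.9)/(18.1) at `e1ppD` (RT-05, skeleton v27+), so no skeleton binder is
affected; the node `EqB_3R` (and with it the printed-value `Skeleton.Lemma151ChiR`) was marked «not a
target» in WP15-PLAN §2.1 — this file turns that planning note into a kernel fact for `EqB_3R`.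

WHAT THIS IS NOT: a refutation of Lemma 15.1 in the χ-reading at the stated value
(`Skeleton.Lemma151ChiR`, which is guarded by Assumption (A) and hence not refutable without
(A)-instances), nor any claim about Theorems 1–2 or Landau–Siegel zeros.

## References
* Y. Zhang, arXiv:2211.02515v1 (2022), Appendix B (B.3) p. 108, tex L5317–L5334; Lemma 15.1 p. 86.
  [cite: Zhang2022LandauSiegel, Appendix B (B.3), p.108]
-/

noncomputable section

open Complex Real

namespace Literature.NumberTheory.LFunctions.Zhang2022.Numerics

open Literature.NumberTheory.LFunctions.Zhang2022
open Literature.NumberTheory.LFunctions.Zhang2022.Skeleton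

/-- **REFUTED: (B.3) as printed, reading of record `α₁ = α log T`** — for every (2.13)-constant `c′`,
`¬ Typed.AppendixB.EqB_3R c′` (tail of (B.3) `= e″_{1j}(stated) + O(α₁)`). Proof: the printed chain is
inconsistent (`appB3R_chain_inconsistent`) and its two genuine steps are theorems
(`stepB_u015aR_holds`, `stepB_u015bR_holds`). Class `refuted-misstated` (misprinted closed form of
`e″_{1j}`); repaired statement = `eqB_3_derived_holds`. [cite: Zhang2022LandauSiegel, Appendix B (B.3), p.108] -/
theorem not_eqB_3R (c' : ℝ) : ¬ Typed.AppendixB.EqB_3R c' := fun h =>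
  appB3R_chain_inconsistent c'
    ⟨h, AppendixBVarrho.stepB_u015aR_holds c', AppendixBVarrho.stepB_u015bR_holds c'⟩

/-- **(B.3) with the DERIVED constant is a theorem**: for every `c′` there is `C` with
`‖tailB3 c′ D j l₁ − e1ppD j‖ ≤ C·α₁` for `D` large, `j ∈ {1,2,3}`, `1 ≤ l₁ ∈ 𝔫(𝔮)`, `l₁ < T`
(`AppendixBVarrho.tailB3_sub_e1ppD_of` at `stepB_u015aR_holds`, `stepB_u015bR_holds`) — the input `hB3`
of `Typed.Section15C.eq15_22E_of_appB_legs` at `e1pp := e1ppD`.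
[cite: Zhang2022LandauSiegel, Appendix B (B.3), p.108] -/
theorem eqB_3_derived_holds (c' : ℝ) :
    ∃ C : ℝ, ForAllLarge fun D _ _ =>
      ∀ j ∈ ({1, 2, 3} : Finset ℕ), ∀ l₁ : ℕ, 1 ≤ l₁ → l₁ ∈ nset (frakq D) → (l₁ : ℝ) < bigT D →
        ‖Typed.AppendixB.tailB3 c' D j l₁ - e1ppD j‖ ≤ C * alpha1 D :=
  AppendixBVarrho.tailB3_sub_e1ppD_of c' (AppendixBVarrho.stepB_u015aR_holds c')
    (AppendixBVarrho.stepB_u015bR_holds c')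

/-- The two readings side by side: the printed (B.3) fails and the derived one holds, for every `c′`.
[cite: Zhang2022LandauSiegel, Appendix B (B.3), p.108] -/
theorem eqB_3_printed_false_derived_true (c' : ℝ) :
    ¬ Typed.AppendixB.EqB_3R c' ∧
    ∃ C : ℝ, ForAllLarge fun D _ _ =>
      ∀ j ∈ ({1, 2, 3} : Finset ℕ), ∀ l₁ : ℕ, 1 ≤ l₁ → l₁ ∈ nset (frakq D) → (l₁ : ℝ) < bigT D →
        ‖Typed.AppendixB.tailB3 c' D j l₁ - e1ppD j‖ ≤ C * alpha1 D :=
  ⟨not_eqB_3R c', eqB_3_derived_holds c'⟩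


/-- **REFUTED as well: (B.3) in the BANKED reading `α₁ = α𝓛`** (`Typed.AppendixB.EqB_3 c′`, tail of (B.3)
`= e″_{1j}(stated) + O(α𝓛)`, the STRONGER of the two typed readings): it implies `EqB_3R c′` by the tree
edge `Typed.AppendixB.eqB_3R_of` (`α𝓛 ≤ α log T`), which `not_eqB_3R` refutes. Class `refuted-misstated`
(same witness: the misprinted closed form of `e″_{1j}`; repaired statement = `eqB_3_derived_holds`).
[cite: Zhang2022LandauSiegel, Appendix B (B.3), p.108] -/
theorem not_eqB_3 (c' : ℝ) : ¬ Typed.AppendixB.EqB_3 c' := fun h =>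
  not_eqB_3R c' (Typed.AppendixB.eqB_3R_of c' h)

/-- Both typed readings of the printed (B.3) fail, for every `c′`.
[cite: Zhang2022LandauSiegel, Appendix B (B.3), p.108] -/
theorem not_eqB_3_and_not_eqB_3R (c' : ℝ) :
    ¬ Typed.AppendixB.EqB_3 c' ∧ ¬ Typed.AppendixB.EqB_3R c' :=
  ⟨not_eqB_3 c', not_eqB_3R c'⟩

end Literature.NumberTheory.LFunctions.Zhang2022.Numerics
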